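import Summits.NavierStokesRegularity.FluidComputer.ForcedModesWitness
import HarnessLib

/-!
# Forced modes of the symmetric column, II: the complete list

HONEST FRAMING (cell `pub-fluidc`, verbatim): *low prior, high value-of-information experiment on Tao's
machine paradigm; NOT a claim that NS blows up.* Nothing here concerns the Navier–Stokes PDE beyond the
Galerkin-truncated ODE system both engines of the cell integrate.

With the witness families of part I (`ForcedModesWitness`: `swirlW`, `polW`, glide phase `(−1)^{nj}`) and the
companions `SublatticeSupport` (p213261), `DihedralSector` (p214574), `DihedralSectorSharp` (p214969):

* `free_of_offplane` — every sublattice wavevector `k` with `m ∣ k₂ ≠ 0` off the vertical axis carries a non-zero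
  coefficient of some field fixed by `T`, `G_a`, `S_a`, `R` (`a = nπ/m`; the poloidal witness if `n j` is even,
  the swirl witness if it is odd, `k₂ = m j`).
* `forced_iff` — THE CLASSIFICATION: for `m ≥ 1`, `a = nπ/m` and any `k ∈ ℤ³`,
  "every real incompressible field fixed by `T`, `G_a`, `S_a`, `R` has `û(k) = 0`" holds IF AND ONLY IF
  `m ∤ k₂ ∨ (k₀ = 0 ∧ k₁ = 0) ∨ (k₂ = 0 ∧ k₀ k₁ (k₀² − k₁²) = 0)`; `forced_modes_empty` is the dynamic reading of
  the easy direction (persistence along unforced Galerkin solutions on symmetric masks, from the companions).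
* `forced_iff_seeded` — the same for the SEEDED members (`eps_pol > 0`), whose poloidal seed breaks `G_a`
  (certificate F4) and keeps `T`, `S_a`, `R`: the forced set is `m ∤ k₂ ∨ (k₀ = 0 ∧ k₁ = 0)` only — the `z`-mean
  swirl witness `zswirl N = i 1_K (−k₁, k₀, 0)` frees every mirror line, so no shell `|k| ≥ 1` is dead;
  `forced_modes_empty_seeded` is its dynamic reading.

Reading for the engines (information, not a claim about any run): the forced set is EXACTLY the list of
modes an exactly symmetric integration keeps at zero (usable as symmetry diagnostics at every shell); every
other sublattice mode may legitimately carry energy, so content there is never by itself a symmetry defect.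
NOT claimed: anything about round-off, anything dynamical beyond persistence of symmetry, anything for glide
offsets `a ∉ (π/m)ℤ` (there `G_a² = T_{2a}` is an extra vertical translation and the forced set is larger).
0 sorry, 0 named facts (D-0026). [folklore]
-/

noncomputable section

namespace Summit.NavierStokesRegularity.FluidComputer.ForcedModes

open Literature.Analysis.FluidPDE.FluidComputer
open Literature.Analysis.FluidPDE.FluidComputer.ShellTransfer
open Complex
open DihedralSectorSharp

/-! ## Every off-plane sublattice mode off the axis is free -/

/-- **FREE OFF-PLANE MODES.** For `m ≥ 1`, a glide offset `a = nπ/m` and a wavevector `k` with `m ∣ k₂ ≠ 0`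
off the vertical axis, some real incompressible field fixed by `T`, `G_a`, `S_a` and the quarter turn has a
non-zero coefficient at `k` (the poloidal witness if `n j` is even, the swirl witness if it is odd, where
`k₂ = m j`). [folklore] -/
theorem free_of_offplane {m : ℕ} (hm : m ≠ 0) (n : ℤ) {k : Fin 3 → ℤ} (hdvd : (m : ℤ) ∣ k 2)
    (hk2 : k 2 ≠ 0) (hoff : ¬ (k 0 = 0 ∧ k 1 = 0)) :
    ∃ W : FourierVelocity, translate (vertical (2 * Real.pi / m)) W = W ∧
      reflX.sg (vertical (n * Real.pi / m)) W = W ∧ reflZ.sg (vertical (n * Real.pi / m)) W = W ∧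
      rotZ.act W = W ∧ W.coeff k ≠ 0 := by
  obtain ⟨j, hj⟩ := hdvd
  have hc : k 2 ^ 2 = ((m : ℤ) * j) ^ 2 := by rw [hj]
  rcases Int.even_or_odd (n * j) with he | ho
  · refine ⟨polW (k 2 ^ 2) (k 0 ^ 2 + k 1 ^ 2), ?_, ?_, ?_, rotZ_act_polW _ _, polW_coeff_ne_zero hk2 hoff⟩
    · rw [hc]; exact translate_period_polW hm j _
    · rw [hc]; exact reflX_sg_polW hm he _
    · rw [hc]; exact reflZ_sg_polW hm he _
  · refine ⟨swirlW (k 2 ^ 2) (k 0 ^ 2 + k 1 ^ 2), ?_, ?_, ?_, rotZ_act_swirlW _ _,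
      swirlW_coeff_ne_zero hk2 hoff⟩
    · rw [hc]; exact translate_period_swirlW hm j _
    · rw [hc]; exact reflX_sg_swirlW hm ho _
    · rw [hc]; exact reflZ_sg_swirlW hm ho _

/-! ## The classification -/

/-- **FORCED MODES — THE COMPLETE LIST.** For `m ≥ 1`, a commensurate glide offset `a = nπ/m` (`n : ℤ`) and
any wavevector `k ∈ ℤ³`: every real incompressible Fourier coefficient field fixed by the one-period vertical
translation `T`, the glides `G_a = T_a ∘ (x ↦ -x)`, `S_a = T_a ∘ (z ↦ -z)` and the quarter turn vanishes at
`k` IF AND ONLY IF `k` is off the sublattice (`m ∤ k₂`), on the vertical axis (`k₀ = k₁ = 0`), or on a mirror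
line of the `z`-mean plane (`k₂ = 0`, `k₀ k₁ (k₀² − k₁²) = 0`). [folklore] -/
theorem forced_iff {m : ℕ} (hm : m ≠ 0) (n : ℤ) (k : Fin 3 → ℤ) :
    (∀ W : FourierVelocity, translate (vertical (2 * Real.pi / m)) W = W →
        reflX.sg (vertical (n * Real.pi / m)) W = W → reflZ.sg (vertical (n * Real.pi / m)) W = W →
        rotZ.act W = W → W.coeff k = 0) ↔
      (¬ (m : ℤ) ∣ k 2 ∨ (k 0 = 0 ∧ k 1 = 0) ∨ (k 2 = 0 ∧ k 0 * k 1 * (k 0 ^ 2 - k 1 ^ 2) = 0)) := by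
  constructor
  · intro h
    by_contra hnot
    push Not at hnot
    obtain ⟨hdvd, hoff, hplane⟩ := hnot
    by_cases hk2 : k 2 = 0
    · exact witness_coeff_ne_zero hk2 (hplane hk2)
        (h _ (translate_vertical_witness _ _) (reflX_sg_witness _ _) (reflZ_sg_witness _ _)
          (rotZ_act_witness _))
    · have hoff' : ¬ (k 0 = 0 ∧ k 1 = 0) := fun h01 => hoff h01.1 h01.2
      obtain ⟨W, hT, hX, hZ, hR, hW⟩ := free_of_offplane hm n hdvd hk2 hoff'
      exact hW (h W hT hX hZ hR)
  · rintro (hnd | ⟨hk0, hk1⟩ | ⟨hk2, hline⟩) W hT hX hZ hR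
    · exact SublatticeSupport.coeff_eq_zero_of_periodic hm hT hnd
    · exact coeff_eq_zero_of_horizontal_mean hZ hR hk0 hk1
    · exact DihedralSector.coeff_eq_zero_of_mirror_line hX hZ hR hk2 ((mirrorLine_iff k).mp hline)

/-- **THE FORCED SET IS EMPTY AT ALL TIMES** (the easy direction, read dynamically; assembled from
`SublatticeSupport`, `DihedralSectorSharp` and `DihedralSector`). Along an unforced Galerkin solution (any `ν`,
any pressure multiplier) on a mode set closed under the three point operations, whose datum at one time is
fixed by `T`, `G_a`, `S_a` and the quarter turn, every wavevector of the forced set carries zero coefficient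
and zero modal energy at every time. [folklore] -/
theorem forced_modes_empty {U : ℝ → FourierVelocity} {S : Finset (Fin 3 → ℤ)} {ν : ℝ}
    {c : ℝ → (Fin 3 → ℤ) → ℂ} (hU : IsGalerkinSolution U S ν c fun _ _ _ => 0) (hs : IsSupportedOn U S)
    (hX : ∀ p ∈ S, reflX.invK p ∈ S) (hX' : ∀ p ∈ S, reflX.actK p ∈ S)
    (hZ : ∀ p ∈ S, reflZ.invK p ∈ S) (hZ' : ∀ p ∈ S, reflZ.actK p ∈ S)
    (hRi : ∀ p ∈ S, rotZ.invK p ∈ S) (hRa : ∀ p ∈ S, rotZ.actK p ∈ S)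
    {m : ℕ} (hm : m ≠ 0) {a t₀ : ℝ} (hT : translate (vertical (2 * Real.pi / m)) (U t₀) = U t₀)
    (hG : reflX.sg (vertical a) (U t₀) = U t₀) (hSz : reflZ.sg (vertical a) (U t₀) = U t₀)
    (hR : rotZ.act (U t₀) = U t₀) (t : ℝ) {k : Fin 3 → ℤ}
    (hk : ¬ (m : ℤ) ∣ k 2 ∨ (k 0 = 0 ∧ k 1 = 0) ∨ (k 2 = 0 ∧ k 0 * k 1 * (k 0 ^ 2 - k 1 ^ 2) = 0)) :
    (U t).coeff k = 0 ∧ modalEnergy (U t) k = 0 := by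
  rcases hk with hnd | ⟨hk0, hk1⟩ | ⟨hk2, hline⟩
  · exact ⟨SublatticeSupport.coeff_eq_zero_persists hU hs hm hT t hnd,
      SublatticeSupport.modalEnergy_eq_zero_persists hU hs hm hT t hnd⟩
  · exact horizontal_mean_empty hU hs hZ hZ' hRi hRa hSz hR t hk0 hk1
  · exact DihedralSector.mirror_lines_empty hU hs hX hX' hZ hZ' hRi hRa hG hSz hR t hk2
      ((mirrorLine_iff k).mp hline)

/-! ## Without the vertical mirror: the seeded members (`eps_pol > 0`)

The poloidal seed of the cell's `houluo` family is exactly the `G`-odd component of the datum (certificate F4,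
`code/gadgets/tests/houluo_lowshell_cert_j091074.md`): the seeded members keep `T`, `S_a` and the quarter turn but NOT
`G_a`. For that smaller group the `z`-mean mirror lines are no longer forced — the `z`-mean swirl field below is a
witness on every circle — and the forced set shrinks to `{m ∤ k₂} ∪ {axis}`: no shell `|k| ≥ 1` is dead. -/

/-- `1_K` for the circle `K = {k₂ = 0, k₀² + k₁² = N}`. [folklore] -/
def oneK (N : ℤ) (k : Fin 3 → ℤ) : ℤ := if k 2 = 0 ∧ k 0 ^ 2 + k 1 ^ 2 = N then 1 else 0

/-- `1_K` on the circle. [folklore] -/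
theorem oneK_of_mem {N : ℤ} {k : Fin 3 → ℤ} (h : k 2 = 0 ∧ k 0 ^ 2 + k 1 ^ 2 = N) : oneK N k = 1 := if_pos h

/-- `1_K` off the circle. [folklore] -/
theorem oneK_of_not_mem {N : ℤ} {k : Fin 3 → ℤ} (h : ¬ (k 2 = 0 ∧ k 0 ^ 2 + k 1 ^ 2 = N)) : oneK N k = 0 :=
  if_neg h

/-- `1_K` vanishes off the `z`-mean plane. [folklore] -/
theorem oneK_of_ne {N : ℤ} {k : Fin 3 → ℤ} (h : k 2 ≠ 0) : oneK N k = 0 := oneK_of_not_mem fun h' => h h'.1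

/-- `1_K(-k) = 1_K(k)`. [folklore] -/
theorem oneK_neg (N : ℤ) (k : Fin 3 → ℤ) : oneK N (-k) = oneK N k := by
  by_cases h : k 2 = 0 ∧ k 0 ^ 2 + k 1 ^ 2 = N
  · have h' : (-k) 2 = 0 ∧ (-k) 0 ^ 2 + (-k) 1 ^ 2 = N := by
      simpa only [Pi.neg_apply, neg_eq_zero, neg_sq] using h
    rw [oneK_of_mem h, oneK_of_mem h']
  · have h' : ¬ ((-k) 2 = 0 ∧ (-k) 0 ^ 2 + (-k) 1 ^ 2 = N) := by
      simpa only [Pi.neg_apply, neg_eq_zero, neg_sq] using h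
    rw [oneK_of_not_mem h, oneK_of_not_mem h']

/-- `1_K(k₁, -k₀, k₂) = 1_K(k)`. [folklore] -/
theorem oneK_rotZ (N : ℤ) (k : Fin 3 → ℤ) : oneK N ![k 1, -k 0, k 2] = oneK N k := by
  by_cases h : k 2 = 0 ∧ k 0 ^ 2 + k 1 ^ 2 = N
  · have h' : (![k 1, -k 0, k 2] : Fin 3 → ℤ) 2 = 0 ∧
        (![k 1, -k 0, k 2] : Fin 3 → ℤ) 0 ^ 2 + (![k 1, -k 0, k 2] : Fin 3 → ℤ) 1 ^ 2 = N := by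
      refine ⟨by simp [h.1], ?_⟩
      simp only [Matrix.cons_val_zero, Matrix.cons_val_one, neg_sq]; linarith [h.2]
    rw [oneK_of_mem h, oneK_of_mem h']
  · have h' : ¬ ((![k 1, -k 0, k 2] : Fin 3 → ℤ) 2 = 0 ∧
        (![k 1, -k 0, k 2] : Fin 3 → ℤ) 0 ^ 2 + (![k 1, -k 0, k 2] : Fin 3 → ℤ) 1 ^ 2 = N) := by
      rintro ⟨h2, hN⟩
      refine h ⟨by simpa using h2, ?_⟩
      simp only [Matrix.cons_val_zero, Matrix.cons_val_one, neg_sq] at hN; linarith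
    rw [oneK_of_not_mem h, oneK_of_not_mem h']

/-- `1_K(k₀, k₁, -k₂) = 1_K(k)`. [folklore] -/
theorem oneK_reflZ (N : ℤ) (k : Fin 3 → ℤ) : oneK N ![k 0, k 1, -k 2] = oneK N k := by
  by_cases h : k 2 = 0 ∧ k 0 ^ 2 + k 1 ^ 2 = N
  · have h' : (![k 0, k 1, -k 2] : Fin 3 → ℤ) 2 = 0 ∧
        (![k 0, k 1, -k 2] : Fin 3 → ℤ) 0 ^ 2 + (![k 0, k 1, -k 2] : Fin 3 → ℤ) 1 ^ 2 = N :=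
      ⟨by simp [h.1], by simpa using h.2⟩
    rw [oneK_of_mem h, oneK_of_mem h']
  · have h' : ¬ ((![k 0, k 1, -k 2] : Fin 3 → ℤ) 2 = 0 ∧
        (![k 0, k 1, -k 2] : Fin 3 → ℤ) 0 ^ 2 + (![k 0, k 1, -k 2] : Fin 3 → ℤ) 1 ^ 2 = N) := by
      rintro ⟨h2, hN⟩
      exact h ⟨by simpa using h2, by simpa using hN⟩
    rw [oneK_of_not_mem h, oneK_of_not_mem h']

/-- **The `z`-mean swirl witness** `û(k) = i 1_K(k) (−k₁, k₀, 0)`: horizontal, incompressible, `z`-independent,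
reversed by `x ↦ -x` (it is `G`-odd) but fixed by `z ↦ -z` and the quarter turn. [folklore] -/
def zswirl (N : ℤ) : FourierVelocity where
  coeff k := ![-(I * (((k 1 * oneK N k : ℤ)) : ℂ)), I * (((k 0 * oneK N k : ℤ)) : ℂ), 0]
  reality k i := by
    fin_cases i
    · simp [oneK_neg]
    · simp [oneK_neg]
    · simp
  divFree k := by
    simp [Fin.sum_univ_three]; ring

/-- `û₀ = -i k₁ 1_K`. [folklore] -/
@[simp] theorem zswirl_coeff_zero (N : ℤ) (k : Fin 3 → ℤ) :
    (zswirl N).coeff k 0 = -(I * (((k 1 * oneK N k : ℤ)) : ℂ)) := rfl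

/-- `û₁ = i k₀ 1_K`. [folklore] -/
@[simp] theorem zswirl_coeff_one (N : ℤ) (k : Fin 3 → ℤ) :
    (zswirl N).coeff k 1 = I * (((k 0 * oneK N k : ℤ)) : ℂ) := rfl

/-- `û₂ = 0`. [folklore] -/
@[simp] theorem zswirl_coeff_two (N : ℤ) (k : Fin 3 → ℤ) : (zswirl N).coeff k 2 = 0 := rfl

/-- The quarter turn fixes the `z`-mean swirl witness. [folklore] -/
theorem rotZ_act_zswirl (N : ℤ) : rotZ.act (zswirl N) = zswirl N := by
  apply TaylorGreenHat.fourierVelocity_ext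
  funext k j
  rw [LatticeIsometry.act_coeff, rotZ_invK]
  unfold rotZ
  fin_cases j <;> simp [Fin.sum_univ_three, oneK_rotZ]

/-- The plain reflection `z ↦ -z` fixes the `z`-mean swirl witness. [folklore] -/
theorem reflZ_act_zswirl (N : ℤ) : reflZ.act (zswirl N) = zswirl N := by
  apply TaylorGreenHat.fourierVelocity_ext
  funext k j
  rw [LatticeIsometry.act_coeff, reflZ_invK]
  unfold reflZ
  fin_cases j <;> simp [Fin.sum_univ_three, oneK_reflZ]

/-- Every vertical translation fixes the `z`-mean swirl witness. [folklore] -/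
theorem translate_vertical_zswirl (N : ℤ) (d : ℝ) : translate (vertical d) (zswirl N) = zswirl N := by
  apply TaylorGreenHat.fourierVelocity_ext
  funext k j
  rw [translate_coeff]
  by_cases hk2 : k 2 = 0
  · rw [DihedralSector.phase_vertical_of_zmean d hk2, one_mul]
  · fin_cases j <;> simp [oneK_of_ne hk2]

/-- Hence `S_a` fixes it for every `a`. [folklore] -/
theorem reflZ_sg_zswirl (N : ℤ) (a : ℝ) : reflZ.sg (vertical a) (zswirl N) = zswirl N := by
  rw [LatticeIsometry.sg_def, reflZ_act_zswirl, translate_vertical_zswirl]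

/-- **Off the vertical axis the `z`-mean swirl witness does not vanish** — mirror lines included. [folklore] -/
theorem zswirl_coeff_ne_zero {k : Fin 3 → ℤ} (hk2 : k 2 = 0) (hoff : ¬ (k 0 = 0 ∧ k 1 = 0)) :
    (zswirl (k 0 ^ 2 + k 1 ^ 2)).coeff k ≠ 0 := by
  have h1 : oneK (k 0 ^ 2 + k 1 ^ 2) k = 1 := oneK_of_mem ⟨hk2, rfl⟩
  intro h
  by_cases hk1 : k 1 = 0
  · have hk0 : k 0 ≠ 0 := fun h0 => hoff ⟨h0, hk1⟩
    have e : (zswirl (k 0 ^ 2 + k 1 ^ 2)).coeff k 1 = 0 := by rw [h]; rfl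
    rw [zswirl_coeff_one, h1, mul_one] at e
    have hk0C : ((k 0 : ℤ) : ℂ) ≠ 0 := by exact_mod_cast hk0
    exact mul_ne_zero I_ne_zero hk0C e
  · have e : (zswirl (k 0 ^ 2 + k 1 ^ 2)).coeff k 0 = 0 := by rw [h]; rfl
    rw [zswirl_coeff_zero, h1, mul_one, neg_eq_zero] at e
    have hk1C : ((k 1 : ℤ) : ℂ) ≠ 0 := by exact_mod_cast hk1
    exact mul_ne_zero I_ne_zero hk1C e

/-- **FORCED MODES WITHOUT THE VERTICAL MIRROR** (the seeded members). For `m ≥ 1`, `a = nπ/m` and any `k`: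
every real incompressible field fixed by `T`, `S_a` and the quarter turn vanishes at `k` IF AND ONLY IF
`m ∤ k₂` or `k` is on the vertical axis. In particular no `z`-mean mirror line is forced and no shell is dead.
[folklore] -/
theorem forced_iff_seeded {m : ℕ} (hm : m ≠ 0) (n : ℤ) (k : Fin 3 → ℤ) :
    (∀ W : FourierVelocity, translate (vertical (2 * Real.pi / m)) W = W →
        reflZ.sg (vertical (n * Real.pi / m)) W = W → rotZ.act W = W → W.coeff k = 0) ↔
      (¬ (m : ℤ) ∣ k 2 ∨ (k 0 = 0 ∧ k 1 = 0)) := by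
  constructor
  · intro h
    by_contra hnot
    push Not at hnot
    obtain ⟨hdvd, hoff⟩ := hnot
    have hoff' : ¬ (k 0 = 0 ∧ k 1 = 0) := fun h01 => hoff h01.1 h01.2
    by_cases hk2 : k 2 = 0
    · exact zswirl_coeff_ne_zero hk2 hoff'
        (h _ (translate_vertical_zswirl _ _) (reflZ_sg_zswirl _ _) (rotZ_act_zswirl _))
    · obtain ⟨W, hT, -, hZ, hR, hW⟩ := free_of_offplane hm n hdvd hk2 hoff'
      exact hW (h W hT hZ hR)
  · rintro (hnd | ⟨hk0, hk1⟩) W hT hZ hR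
    · exact SublatticeSupport.coeff_eq_zero_of_periodic hm hT hnd
    · exact coeff_eq_zero_of_horizontal_mean hZ hR hk0 hk1

/-- … and its dynamic reading: along an unforced Galerkin solution on a mask closed under `z ↦ -z` and the
quarter turn, whose datum is fixed by `T`, `S_a` and the quarter turn, the off-sublattice modes and the vertical
axis are empty at every time. [folklore] -/
theorem forced_modes_empty_seeded {U : ℝ → FourierVelocity} {S : Finset (Fin 3 → ℤ)} {ν : ℝ}
    {c : ℝ → (Fin 3 → ℤ) → ℂ} (hU : IsGalerkinSolution U S ν c fun _ _ _ => 0) (hs : IsSupportedOn U S)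
    (hZ : ∀ p ∈ S, reflZ.invK p ∈ S) (hZ' : ∀ p ∈ S, reflZ.actK p ∈ S)
    (hRi : ∀ p ∈ S, rotZ.invK p ∈ S) (hRa : ∀ p ∈ S, rotZ.actK p ∈ S)
    {m : ℕ} (hm : m ≠ 0) {a t₀ : ℝ} (hT : translate (vertical (2 * Real.pi / m)) (U t₀) = U t₀)
    (hSz : reflZ.sg (vertical a) (U t₀) = U t₀) (hR : rotZ.act (U t₀) = U t₀) (t : ℝ) {k : Fin 3 → ℤ}
    (hk : ¬ (m : ℤ) ∣ k 2 ∨ (k 0 = 0 ∧ k 1 = 0)) : (U t).coeff k = 0 ∧ modalEnergy (U t) k = 0 := by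
  rcases hk with hnd | ⟨hk0, hk1⟩
  · exact ⟨SublatticeSupport.coeff_eq_zero_persists hU hs hm hT t hnd,
      SublatticeSupport.modalEnergy_eq_zero_persists hU hs hm hT t hnd⟩
  · exact horizontal_mean_empty hU hs hZ hZ' hRi hRa hSz hR t hk0 hk1

end Summit.NavierStokesRegularity.FluidComputer.ForcedModes

end
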